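import Literature.Probability.LatticeModels.GinibreModel
import Literature.Analysis.FunctionSpaces.TorusHeatKernel
import Mathlib.Analysis.SpecialFunctions.Exponential
import Mathlib.MeasureTheory.Integral.DominatedConvergence
import Mathlib.MeasureTheory.Measure.Haar.Basic
import HarnessLib

/-!
# The character (duality) expansion of Ginibre models: modified Bessel coefficients,
orthogonality of characters, and `Z⟨χ₀⟩ = ∑_{n ∈ ℤ^ι, χ₀·∏ₐ χₐ^{nₐ} = 1} ∏ₐ I_{nₐ}(Jₐ)`

Companion of `GinibreModel.lean` (the generalised plane-rotator / compact abelian lattice model with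
interaction characters `χₐ : Ω →ₜ* U(1)` and Gibbs weight `e^{∑ₐ Jₐ Re χₐ}` on a compact abelian group
`Ω`) and the first step — the *character expansion*, alias *duality (Fourier) transformation* — of
every weak-coupling analysis of abelian lattice gauge theories (Fröhlich–Spencer 1982 §2.3, Guth
1980 §II, for the four-dimensional `U(1)` theory; Montvay–Münster 1994 §3.2.7 (3.169)–(3.172) for
the coefficients). Everything in this file is PROVED; no named fact is introduced.

* `besselI m x` (`m ∈ ℤ`, `x ∈ ℝ`): the modified Bessel function of the first kind of integer
  order, *defined* by its power series `∑_k (x/2)^{2k+|m|} / (k! (k+|m|)!)`; `besselI_nonneg`,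
  `besselI_pos`, `besselI_neg_index` (`I_{-m} = I_m`), `besselI_neg_arg` (`I_m(-x) = (-1)^m I_m(x)`),
  `abs_besselI` (`|I_m(x)| = I_m(|x|)`), `besselI_zero_right` (`I_m(0) = [m = 0]`).
* `hasSum_besselI_mul_zpow` — **the generating identity on the unit circle**
  `e^{x Re z} = ∑_{m ∈ ℤ} I_m(x) z^m` (`|z| = 1`), i.e. the Fourier (character) expansion of the
  Wilson plaquette weight `e^{β cos θ} = ∑_m I_m(β) e^{imθ}` (Montvay–Münster (3.171)–(3.172):
  `c_n = I_n(β) e^{-β}` for the normalised weight `e^{-β(1 - cos θ)}`), proved from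
  `e^{(x/2)z} e^{(x/2)z⁻¹}` by the Cauchy product and the diagonal reindexing `ℕ × ℕ ≃ ℤ × ℕ`;
  `summable_abs_besselI`, `tsum_besselI` (`∑_m I_m(x) = e^x`).
* `integral_coe_char` — **orthogonality**: the Haar integral of a continuous unitary character of
  a compact abelian group is `1` for the trivial character and `0` otherwise.
* `twistChar χ χ₀ n = χ₀ · ∏ₐ χₐ^{nₐ}` (a continuous character) and the generic expansion
  `integral_coe_char_mul_prod_tsum`: for absolutely summable coefficients `cₐ : ℤ → ℂ`,
  `∫ χ₀(θ) ∏ₐ (∑_m cₐ(m) χₐ(θ)^m) dθ = ∑_{n ∈ ℤ^ι} [twistChar χ χ₀ n = 1] ∏ₐ cₐ(nₐ)`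
  (Fubini for the absolutely convergent multiple series, then orthogonality).
* The Ginibre weight is such a product (`coe_ginibreWeight_eq_prod_tsum`), whence
  `integral_coe_char_mul_ginibreWeight`, `integral_reChar_mul_ginibreWeight`,
  `integral_ginibreWeight_eq_tsum` and `ginibreExpect_reChar_eq_tsum_div_tsum`:
  `⟨Re χ₀⟩_J = (∑_n [χ₀ ∏ₐ χₐ^{nₐ} = 1] ∏ₐ I_{nₐ}(Jₐ)) / (∑_n [∏ₐ χₐ^{nₐ} = 1] ∏ₐ I_{nₐ}(Jₐ))` —
  for `U(1)` lattice gauge theory (`χₐ` = plaquette holonomies, `χ₀` = a Wilson loop) this is the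
  representation of `Z_Λ⟨W(ℒ)⟩_Λ` as a sum over integer plaquette fields `n` whose boundary is the
  loop, weighted by `∏ₚ I_{nₚ}(β)` (Fröhlich–Spencer 1982 §2.3; Guth 1980 §II).

## References

* I. Montvay, G. Münster, *Quantum Fields on a Lattice* (CUP 1994), §3.2.7, (3.169)–(3.172)
  (PDF p. 128 of the held copy): character expansion of the `U(1)` Wilson plaquette weight,
  `c_n = I_n(β) e^{-β}`. [MontvayMunster1994]
* J. Fröhlich, T. Spencer, Comm. Math. Phys. 83 (1982) 411–454, §2.3 (duality transformation of
  the `U(1)` theory to the `ℤ`-valued dual model). [FrohlichSpencerCMP1982]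
* A. H. Guth, Phys. Rev. D 21 (1980) 2291–2307, §II. [Guth1980]
* J. Ginibre, Comm. Math. Phys. 16 (1970) 310–328 (the models). [Ginibre1970]
-/

noncomputable section

open MeasureTheory Filter Finset
open scoped Topology BigOperators Nat

namespace Literature.Probability.LatticeModels

/-! ### Modified Bessel functions of integer order -/

section Bessel

/-- The `k`-th term `(x/2)^{2k+|m|} / (k! (k+|m|)!)` of the power series of the modified Bessel
function `I_m(x)`. [folklore] -/
def besselITerm (m : ℤ) (x : ℝ) (k : ℕ) : ℝ :=
  (x / 2) ^ (2 * k + m.natAbs) / ((k ! : ℝ) * ((k + m.natAbs)! : ℝ))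

/-- **The modified Bessel function of the first kind of integer order**,
`I_m(x) = ∑_{k ≥ 0} (x/2)^{2k+|m|} / (k! (k+|m|)!)` (`m ∈ ℤ`, so that `I_{-m} = I_m` by
definition). These are the Fourier coefficients of the Wilson plaquette weight:
`e^{x cos θ} = ∑_m I_m(x) e^{imθ}` (`hasSum_besselI_mul_zpow`).
[cite: MontvayMunster1994, §3.2.7 (3.171)–(3.172) (PDF p. 128)] -/
def besselI (m : ℤ) (x : ℝ) : ℝ :=
  ∑' k : ℕ, besselITerm m x k

/-- The Bessel terms are dominated by the exponential series:
`|(x/2)^{2k+|m|} / (k!(k+|m|)!)| ≤ (|x|/2)^{|m|} ((|x|/2)²)^k / k!`. [folklore] -/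
theorem abs_besselITerm_le (m : ℤ) (x : ℝ) (k : ℕ) :
    |besselITerm m x k| ≤ (|x| / 2) ^ m.natAbs * (((|x| / 2) ^ 2) ^ k / k !) := by
  have hk : (0 : ℝ) < k ! := by exact_mod_cast Nat.factorial_pos k
  have hkm : (1 : ℝ) ≤ (k + m.natAbs)! := by exact_mod_cast Nat.succ_le_of_lt (Nat.factorial_pos _)
  rw [besselITerm, abs_div, abs_pow, abs_mul, abs_of_pos hk, abs_of_pos (lt_of_lt_of_le one_pos hkm),
    abs_div, abs_two, pow_add, pow_mul]
  rw [div_le_iff₀ (mul_pos hk (lt_of_lt_of_le one_pos hkm))]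
  calc ((|x| / 2) ^ 2) ^ k * (|x| / 2) ^ m.natAbs
      = (|x| / 2) ^ m.natAbs * (((|x| / 2) ^ 2) ^ k / k !) * (k ! * 1) := by
        field_simp
    _ ≤ (|x| / 2) ^ m.natAbs * (((|x| / 2) ^ 2) ^ k / k !) * (k ! * (k + m.natAbs)! : ℝ) := by
        gcongr

/-- The Bessel series converges (absolutely). [folklore] -/
theorem summable_besselITerm (m : ℤ) (x : ℝ) : Summable (besselITerm m x) := by
  refine Summable.of_norm_bounded
    ((Real.summable_pow_div_factorial ((|x| / 2) ^ 2)).mul_left ((|x| / 2) ^ m.natAbs)) fun k => ?_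
  rw [Real.norm_eq_abs]
  exact abs_besselITerm_le m x k

/-- The series sums to `I_m(x)`. [folklore] -/
theorem hasSum_besselITerm (m : ℤ) (x : ℝ) : HasSum (besselITerm m x) (besselI m x) :=
  (summable_besselITerm m x).hasSum

/-- The Bessel terms are non-negative for `x ≥ 0`. [folklore] -/
theorem besselITerm_nonneg {x : ℝ} (hx : 0 ≤ x) (m : ℤ) (k : ℕ) : 0 ≤ besselITerm m x k := by
  unfold besselITerm
  positivity

/-- `I_m(x) ≥ 0` for `x ≥ 0`. [folklore] -/
theorem besselI_nonneg {x : ℝ} (hx : 0 ≤ x) (m : ℤ) : 0 ≤ besselI m x :=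
  tsum_nonneg (besselITerm_nonneg hx m)

/-- `I_m(x) > 0` for `x > 0` (every term of the series is positive). [folklore] -/
theorem besselI_pos {x : ℝ} (hx : 0 < x) (m : ℤ) : 0 < besselI m x := by
  refine (summable_besselITerm m x).tsum_pos (besselITerm_nonneg hx.le m) 0 ?_
  unfold besselITerm
  positivity

/-- `I_{-m} = I_m`. [folklore] -/
@[simp] theorem besselI_neg_index (m : ℤ) (x : ℝ) : besselI (-m) x = besselI m x := by
  simp [besselI, besselITerm, Int.natAbs_neg]

/-- `I_m(-x) = (-1)^{|m|} I_m(x)`. [folklore] -/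
theorem besselI_neg_arg (m : ℤ) (x : ℝ) : besselI m (-x) = (-1) ^ m.natAbs * besselI m x := by
  rw [besselI, besselI, ← tsum_mul_left]
  refine tsum_congr fun k => ?_
  simp only [besselITerm]
  rw [neg_div, neg_pow, pow_add, pow_mul, neg_one_sq, one_pow, one_mul]
  ring

/-- `|I_m(x)| = I_m(|x|)`. [folklore] -/
theorem abs_besselI (m : ℤ) (x : ℝ) : |besselI m x| = besselI m |x| := by
  rcases le_or_gt 0 x with hx | hx
  · rw [abs_of_nonneg hx, abs_of_nonneg (besselI_nonneg hx m)]
  · have h : besselI m x = (-1) ^ m.natAbs * besselI m |x| := by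
      rw [abs_of_neg hx, besselI_neg_arg, ← mul_assoc, ← mul_pow, neg_mul_neg, one_mul, one_pow,
        one_mul]
    rw [h, abs_mul, abs_pow, abs_neg, abs_one, one_pow, one_mul,
      abs_of_nonneg (besselI_nonneg (abs_nonneg x) m)]

/-- `I_m(0) = 1` if `m = 0` and `0` otherwise (a switched-off coupling forces the dual variable to
vanish). [folklore] -/
theorem besselI_zero_right (m : ℤ) : besselI m 0 = if m = 0 then 1 else 0 := by
  unfold besselI
  split_ifs with hm
  · subst hm
    rw [tsum_eq_single 0]
    · simp [besselITerm]
    · intro k hk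
      simp [besselITerm, hk]
  · have hm' : m.natAbs ≠ 0 := by simpa [Int.natAbs_eq_zero] using hm
    have h : ∀ k : ℕ, besselITerm m 0 k = 0 := fun k => by
      have hpos : 2 * k + m.natAbs ≠ 0 := by omega
      simp [besselITerm, zero_pow hpos]
    simp [h]

/-! #### The generating identity `e^{x Re z} = ∑_m I_m(x) z^m` on the unit circle -/

/-- The diagonal reindexing `ℤ × ℕ ≃ ℕ × ℕ`, `(m, i) ↦ (i + m⁺, i + m⁻)`, inverse
`(j, k) ↦ (j - k, min j k)` (collects the Cauchy product `∑_{j,k} aʲbᵏ` along `j - k = m`).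
[folklore] -/
def diagEquiv : ℤ × ℕ ≃ ℕ × ℕ where
  toFun p := (p.2 + p.1.toNat, p.2 + (-p.1).toNat)
  invFun q := ((q.1 : ℤ) - q.2, min q.1 q.2)
  left_inv p := by
    obtain ⟨m, i⟩ := p
    ext <;> simp only <;> omega
  right_inv q := by
    obtain ⟨j, k⟩ := q
    ext <;> simp only <;> omega

/-- `diagEquiv (m, i) = (i + m⁺, i + m⁻)`. [folklore] -/
@[simp] theorem diagEquiv_apply (m : ℤ) (i : ℕ) :
    diagEquiv (m, i) = (i + m.toNat, i + (-m).toNat) := rfl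

/-- The summand of the Cauchy product along the diagonal `j - k = m` is the Bessel term times
`z^m`: `((x/2)z)^{i+m⁺}/(i+m⁺)! · ((x/2)z⁻¹)^{i+m⁻}/(i+m⁻)! = (x/2)^{2i+|m|}/(i!(i+|m|)!) · z^m`
(`z ≠ 0`). [folklore] -/
theorem cauchy_term_diag (x : ℝ) {z : ℂ} (hz : z ≠ 0) (m : ℤ) (i : ℕ) :
    ((x : ℂ) / 2 * z) ^ (i + m.toNat) / ((i + m.toNat)! : ℂ) *
        (((x : ℂ) / 2 * z⁻¹) ^ (i + (-m).toNat) / ((i + (-m).toNat)! : ℂ)) =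
      (besselITerm m x i : ℂ) * z ^ m := by
  have hzi : ∀ k : ℕ, z ^ k ≠ 0 := fun k => pow_ne_zero k hz
  obtain ⟨n, rfl | rfl⟩ := m.eq_nat_or_neg
  · simp only [Int.toNat_natCast, Int.toNat_neg_natCast, add_zero, Int.natAbs_natCast, besselITerm,
      zpow_natCast, mul_pow, inv_pow]
    push_cast
    field_simp
    ring
  · simp only [neg_neg, Int.toNat_natCast, Int.toNat_neg_natCast, add_zero, Int.natAbs_neg,
      Int.natAbs_natCast, besselITerm, zpow_neg, zpow_natCast, mul_pow, inv_pow]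
    push_cast
    field_simp
    ring

/-- The Cauchy product of the two exponential series `e^{(x/2)z} e^{(x/2)z⁻¹}`, summed over
`ℕ × ℕ` and reindexed along the diagonals by `diagEquiv`. [folklore] -/
theorem hasSum_cauchy_diag (x : ℝ) (z : ℂ) :
    HasSum (fun p : ℤ × ℕ =>
      ((x : ℂ) / 2 * z) ^ (diagEquiv p).1 / ((diagEquiv p).1 ! : ℂ) *
        (((x : ℂ) / 2 * z⁻¹) ^ (diagEquiv p).2 / ((diagEquiv p).2 ! : ℂ)))
      (Complex.exp ((x : ℂ) / 2 * z) * Complex.exp ((x : ℂ) / 2 * z⁻¹)) := by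
  have ha : HasSum (fun j : ℕ => ((x : ℂ) / 2 * z) ^ j / j !) (Complex.exp ((x : ℂ) / 2 * z)) := by
    rw [Complex.exp_eq_exp_ℂ]; exact NormedSpace.expSeries_div_hasSum_exp _
  have hb : HasSum (fun k : ℕ => ((x : ℂ) / 2 * z⁻¹) ^ k / k !)
      (Complex.exp ((x : ℂ) / 2 * z⁻¹)) := by
    rw [Complex.exp_eq_exp_ℂ]; exact NormedSpace.expSeries_div_hasSum_exp _
  have hn : ∀ w : ℂ, Summable fun j : ℕ => ‖w ^ j / (j ! : ℂ)‖ := fun w => by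
    simpa [norm_div, norm_pow, Complex.norm_natCast] using Real.summable_pow_div_factorial ‖w‖
  -- the summands are given explicitly: unifying `?f q.1 * ?g q.2` against the product is not a
  -- higher-order pattern and sends the unifier into `whnf`
  have hF := HasSum.mul (f := fun j : ℕ => ((x : ℂ) / 2 * z) ^ j / (j ! : ℂ))
    (g := fun k : ℕ => ((x : ℂ) / 2 * z⁻¹) ^ k / (k ! : ℂ)) ha hb
    (summable_mul_of_summable_norm (f := fun j : ℕ => ((x : ℂ) / 2 * z) ^ j / (j ! : ℂ))
      (g := fun k : ℕ => ((x : ℂ) / 2 * z⁻¹) ^ k / (k ! : ℂ)) (hn _) (hn _))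
  exact (diagEquiv.hasSum_iff (f := fun q : ℕ × ℕ => ((x : ℂ) / 2 * z) ^ q.1 / (q.1 ! : ℂ) *
    (((x : ℂ) / 2 * z⁻¹) ^ q.2 / (q.2 ! : ℂ)))).2 hF

/-- The diagonal `j - k = m` of the Cauchy product sums to `I_m(x) z^m`. [folklore] -/
theorem hasSum_cauchy_fiber (x : ℝ) {z : ℂ} (hz : z ≠ 0) (m : ℤ) :
    HasSum (fun i : ℕ =>
      ((x : ℂ) / 2 * z) ^ (diagEquiv (m, i)).1 / ((diagEquiv (m, i)).1 ! : ℂ) *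
        (((x : ℂ) / 2 * z⁻¹) ^ (diagEquiv (m, i)).2 / ((diagEquiv (m, i)).2 ! : ℂ)))
      ((besselI m x : ℂ) * z ^ m) := by
  have h1 : (fun i : ℕ =>
      ((x : ℂ) / 2 * z) ^ (diagEquiv (m, i)).1 / ((diagEquiv (m, i)).1 ! : ℂ) *
        (((x : ℂ) / 2 * z⁻¹) ^ (diagEquiv (m, i)).2 / ((diagEquiv (m, i)).2 ! : ℂ))) =
      fun i : ℕ => (besselITerm m x i : ℂ) * z ^ m := by
    funext i
    exact cauchy_term_diag x hz m i
  rw [h1, besselI, Complex.ofReal_tsum, ← tsum_mul_right]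
  exact ((Complex.summable_ofReal.2 (summable_besselITerm m x)).mul_right _).hasSum

/-- **The generating identity of the modified Bessel functions on the unit circle**:
`∑_{m ∈ ℤ} I_m(x) z^m = e^{x Re z}` for `|z| = 1` — with `z = e^{iθ}`, the Fourier expansion
`e^{x cos θ} = ∑_m I_m(x) e^{imθ}` of the Wilson plaquette weight. Proof: Cauchy product
`e^{(x/2)z} e^{(x/2)z⁻¹} = ∑_{j,k} ((x/2)z)ʲ((x/2)z⁻¹)ᵏ/(j!k!)`, regrouped along `j - k = m`, and
`z + z⁻¹ = 2 Re z` on the circle. [cite: MontvayMunster1994, §3.2.7 (3.169)–(3.172) (PDF p. 128)] -/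
theorem hasSum_besselI_mul_zpow (x : ℝ) (z : Circle) :
    HasSum (fun m : ℤ => (besselI m x : ℂ) * (z : ℂ) ^ m) (Real.exp (x * (z : ℂ).re) : ℂ) := by
  have hz : (z : ℂ) ≠ 0 := Circle.coe_ne_zero z
  have hsum := (hasSum_cauchy_diag x (z : ℂ)).prod_fiberwise (hasSum_cauchy_fiber x hz)
  have hval : Complex.exp ((x : ℂ) / 2 * z) * Complex.exp ((x : ℂ) / 2 * (z : ℂ)⁻¹) =
      (Real.exp (x * (z : ℂ).re) : ℂ) := by
    rw [← Complex.exp_add, Complex.ofReal_exp, ← Circle.coe_inv, Circle.coe_inv_eq_conj, ← mul_add,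
      Complex.add_conj]
    push_cast
    ring_nf
  rwa [hval] at hsum

/-- `m ↦ I_m(|x|)` is summable (all terms are non-negative and the sum is `e^{|x|}`); this is the
absolute summability `∑_m |I_m(x)| < ∞` of the Fourier coefficients of `e^{x cos θ}`. [folklore] -/
theorem summable_abs_besselI (x : ℝ) : Summable fun m : ℤ => |besselI m x| := by
  have h := hasSum_besselI_mul_zpow |x| 1
  simp only [Circle.coe_one, one_zpow, mul_one] at h
  simp_rw [abs_besselI]
  exact Complex.summable_ofReal.1 h.summable

/-- `∑_{m ∈ ℤ} I_m(x) = e^x`. [folklore] -/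
theorem hasSum_besselI (x : ℝ) : HasSum (fun m : ℤ => besselI m x) (Real.exp x) := by
  have h := hasSum_besselI_mul_zpow x 1
  simp only [Circle.coe_one, one_zpow, mul_one, Complex.one_re] at h
  exact Complex.hasSum_ofReal.1 h

/-- The complex coefficients `m ↦ I_m(x)` are absolutely summable. [folklore] -/
theorem summable_norm_coe_besselI (x : ℝ) : Summable fun m : ℤ => ‖(besselI m x : ℂ)‖ := by
  simpa only [Complex.norm_real, Real.norm_eq_abs] using summable_abs_besselI x

end Bessel

/-! ### Orthogonality of characters of a compact abelian group -/

section Orthogonality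

variable {Ω : Type*} [CommGroup Ω] [TopologicalSpace Ω] [IsTopologicalGroup Ω]
  [MeasurableSpace Ω] [BorelSpace Ω]

/-- The Haar integral of a non-trivial continuous unitary character vanishes: by invariance
`∫ χ(ψθ) dθ = ∫ χ(θ) dθ = χ(ψ) ∫ χ(θ) dθ` with `χ(ψ) ≠ 1`. [folklore] -/
theorem integral_coe_char_eq_zero (μ : Measure Ω) [μ.IsHaarMeasure] (χ : Ω →ₜ* Circle)
    (hχ : χ ≠ 1) : ∫ θ, ((χ θ : Circle) : ℂ) ∂μ = 0 := by
  have hex : ∃ ψ : Ω, χ ψ ≠ 1 := by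
    by_contra h
    push Not at h
    exact hχ (ContinuousMonoidHom.ext h)
  obtain ⟨ψ, hψ⟩ := hex
  set f : Ω → ℂ := fun θ => ((χ θ : Circle) : ℂ) with hf
  have hinv : ∫ θ, f (ψ * θ) ∂μ = ∫ θ, f θ ∂μ := integral_mul_left_eq_self f ψ
  have hmul : ∫ θ, f (ψ * θ) ∂μ = ((χ ψ : Circle) : ℂ) * ∫ θ, f θ ∂μ := by
    rw [← integral_const_mul]
    refine integral_congr_ae (ae_of_all _ fun θ => ?_)
    simp [hf, map_mul]
  have h1 : (((χ ψ : Circle) : ℂ) - 1) * ∫ θ, f θ ∂μ = 0 := by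
    rw [sub_mul, one_mul, ← hmul, hinv, sub_self]
  rcases mul_eq_zero.1 h1 with h | h
  · exact absurd (Circle.ext (by simpa [sub_eq_zero] using h)) hψ
  · exact h

omit [IsTopologicalGroup Ω] [BorelSpace Ω] in
/-- The Haar integral (probability normalisation) of the trivial character is `1`. [folklore] -/
theorem integral_coe_char_one (μ : Measure Ω) [IsProbabilityMeasure μ] :
    ∫ θ, (((1 : Ω →ₜ* Circle) θ : Circle) : ℂ) ∂μ = 1 := by
  simp

open Classical in
/-- **Orthogonality of characters**: for the normalised Haar measure of a compact abelian group
and a continuous unitary character `χ`, `∫ χ dθ = [χ = 1]`. [folklore] -/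
theorem integral_coe_char (μ : Measure Ω) [μ.IsHaarMeasure] [IsProbabilityMeasure μ]
    (χ : Ω →ₜ* Circle) : ∫ θ, ((χ θ : Circle) : ℂ) ∂μ = if χ = 1 then 1 else 0 := by
  split_ifs with h
  · subst h; exact integral_coe_char_one μ
  · exact integral_coe_char_eq_zero μ χ h

end Orthogonality

/-! ### The character expansion -/

section Expansion

variable {Ω : Type*} [CommGroup Ω] [TopologicalSpace Ω]
variable {ι : Type*} [Fintype ι]

/-- The **twisted character** `θ ↦ χ₀(θ) ∏ₐ χₐ(θ)^{nₐ}` attached to a multi-index `n ∈ ℤ^ι`: the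
character whose Haar integral decides whether the term `n` of the character expansion survives.
[folklore] -/
def twistChar (χ : ι → Ω →ₜ* Circle) (χ₀ : Ω →ₜ* Circle) (n : ι → ℤ) : Ω →ₜ* Circle where
  toFun θ := χ₀ θ * ∏ a, (χ a θ) ^ (n a)
  map_one' := by simp
  map_mul' θ θ' := by
    simp only [map_mul, mul_zpow, Finset.prod_mul_distrib]
    exact mul_mul_mul_comm _ _ _ _
  continuous_toFun :=
    χ₀.continuous.mul (continuous_finsetProd _ fun a _ => (χ a).continuous.zpow (n a))

/-- `twistChar χ χ₀ n θ = χ₀(θ) ∏ₐ χₐ(θ)^{nₐ}`. [folklore] -/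
@[simp] theorem twistChar_apply (χ : ι → Ω →ₜ* Circle) (χ₀ : Ω →ₜ* Circle) (n : ι → ℤ) (θ : Ω) :
    twistChar χ χ₀ n θ = χ₀ θ * ∏ a, (χ a θ) ^ (n a) := rfl

/-- The twisted character in `ℂ`: `χ₀(θ) ∏ₐ χₐ(θ)^{nₐ}`. [folklore] -/
theorem coe_twistChar_apply (χ : ι → Ω →ₜ* Circle) (χ₀ : Ω →ₜ* Circle) (n : ι → ℤ) (θ : Ω) :
    ((twistChar χ χ₀ n θ : Circle) : ℂ) = ((χ₀ θ : Circle) : ℂ) * ∏ a, ((χ a θ : Circle) : ℂ) ^ (n a) := by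
  have h : ((∏ a, (χ a θ) ^ (n a) : Circle) : ℂ) = ∏ a, ((χ a θ : Circle) : ℂ) ^ (n a) := by
    have := map_prod Circle.coeHom (fun a => (χ a θ) ^ (n a)) Finset.univ
    simp only [Circle.coeHom_apply, Circle.coe_zpow] at this
    exact this
  simp only [twistChar_apply, Circle.coe_mul, h]

/-- Pointwise character expansion of a product of absolutely convergent character series:
`χ₀(θ) ∏ₐ (∑_m cₐ(m) χₐ(θ)^m) = ∑_{n ∈ ℤ^ι} (∏ₐ cₐ(nₐ)) · χ₀(θ)∏ₐ χₐ(θ)^{nₐ}`, with the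
multi-indexed family summable. [folklore] -/
theorem hasSum_coe_char_mul_prod_tsum [DecidableEq ι] (χ : ι → Ω →ₜ* Circle) (χ₀ : Ω →ₜ* Circle)
    {c : ι → ℤ → ℂ} (hc : ∀ a, Summable fun m => ‖c a m‖) (θ : Ω) :
    HasSum (fun n : ι → ℤ => (∏ a, c a (n a)) * ((twistChar χ χ₀ n θ : Circle) : ℂ))
      (((χ₀ θ : Circle) : ℂ) * ∏ a, ∑' m : ℤ, c a m * ((χ a θ : Circle) : ℂ) ^ m) := by
  have hg : ∀ a, Summable fun m : ℤ => ‖c a m * ((χ a θ : Circle) : ℂ) ^ m‖ := fun a => by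
    simpa [norm_mul, norm_zpow, Circle.norm_coe] using hc a
  obtain ⟨hS, hT⟩ := Literature.Analysis.FunctionSpaces.Torus.tsum_pi_eq_prod_tsum
    (g := fun a (m : ℤ) => c a m * ((χ a θ : Circle) : ℂ) ^ m) hg
  have h1 : HasSum (fun n : ι → ℤ => ∏ a, (c a (n a) * ((χ a θ : Circle) : ℂ) ^ (n a)))
      (∏ a, ∑' m : ℤ, c a m * ((χ a θ : Circle) : ℂ) ^ m) := by
    rw [← hT]; exact hS.hasSum
  have h2 := h1.mul_left (((χ₀ θ : Circle) : ℂ))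
  refine h2.congr_fun fun n => ?_
  rw [coe_twistChar_apply, Finset.prod_mul_distrib]
  ring

/-- The multi-indexed coefficient products `n ↦ ∏ₐ ‖cₐ(nₐ)‖` are summable (`∑ₙ ∏ₐ = ∏ₐ ∑ₘ`).
[folklore] -/
theorem summable_prod_norm [DecidableEq ι] {c : ι → ℤ → ℂ} (hc : ∀ a, Summable fun m => ‖c a m‖) :
    Summable fun n : ι → ℤ => ∏ a, ‖c a (n a)‖ := by
  have hg : ∀ a, Summable fun m : ℤ => ‖((‖c a m‖ : ℝ) : ℂ)‖ := fun a => by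
    simpa using hc a
  have hS := (Literature.Analysis.FunctionSpaces.Torus.tsum_pi_eq_prod_tsum
    (g := fun a (m : ℤ) => ((‖c a m‖ : ℝ) : ℂ)) hg).1
  simp_rw [← Complex.ofReal_prod] at hS
  exact Complex.summable_ofReal.1 hS

/-! ### Ginibre weights -/

/-- The Ginibre weight is a product of Bessel character series:
`e^{∑ₐ Jₐ Re χₐ(θ)} = ∏ₐ ∑_m I_m(Jₐ) χₐ(θ)^m`. [cite: MontvayMunster1994, §3.2.7 (3.171)–(3.172) (PDF p. 128)] -/
theorem coe_ginibreWeight_eq_prod_tsum (χ : ι → Ω →ₜ* Circle) (J : ι → ℝ) (θ : Ω) :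
    (ginibreWeight χ J θ : ℂ) = ∏ a, ∑' m : ℤ, (besselI m (J a) : ℂ) * ((χ a θ : Circle) : ℂ) ^ m := by
  rw [ginibreWeight, ginibreHamiltonian, Real.exp_sum, Complex.ofReal_prod]
  refine Finset.prod_congr rfl fun a _ => ?_
  rw [(hasSum_besselI_mul_zpow (J a) (χ a θ)).tsum_eq, reChar]

/-- In the dual sum only multi-indices supported on the non-zero couplings contribute:
`∏ₐ I_{nₐ}(Jₐ) = 0` as soon as `nₐ ≠ 0` for some `a` with `Jₐ = 0`. [folklore] -/
theorem prod_besselI_eq_zero_of_ne {J : ι → ℝ} {n : ι → ℤ} {a : ι} (hJ : J a = 0) (hn : n a ≠ 0) :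
    ∏ b, besselI (n b) (J b) = 0 :=
  Finset.prod_eq_zero (Finset.mem_univ a) (by rw [hJ, besselI_zero_right, if_neg hn])

/-- The dual weights are non-negative for non-negative couplings. [folklore] -/
theorem prod_besselI_nonneg {J : ι → ℝ} (hJ : ∀ a, 0 ≤ J a) (n : ι → ℤ) :
    0 ≤ ∏ a, besselI (n a) (J a) :=
  Finset.prod_nonneg fun a _ => besselI_nonneg (hJ a) _

/-! ### Integration: the character expansion -/

variable [IsTopologicalGroup Ω] [MeasurableSpace Ω] [BorelSpace Ω]

open Classical in
/-- **The character expansion** (duality transformation): for the normalised Haar measure of a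
compact abelian group, characters `χₐ`, `χ₀` and absolutely summable coefficients `cₐ : ℤ → ℂ`,
`∫ χ₀(θ) ∏ₐ (∑_m cₐ(m) χₐ(θ)^m) dθ = ∑_{n ∈ ℤ^ι} [χ₀ ∏ₐ χₐ^{nₐ} = 1] ∏ₐ cₐ(nₐ)`: expand the
product (`hasSum_coe_char_mul_prod_tsum`), integrate term by term (the series converges
absolutely and uniformly), and use orthogonality (`integral_coe_char`).
[cite: FrohlichSpencerCMP1982, §2.3 (duality transformation); MontvayMunster1994 §3.2.7 (3.169)–(3.171)] -/
theorem integral_coe_char_mul_prod_tsum (μ : Measure Ω) [μ.IsHaarMeasure] [IsProbabilityMeasure μ]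
    (χ : ι → Ω →ₜ* Circle) (χ₀ : Ω →ₜ* Circle) {c : ι → ℤ → ℂ}
    (hc : ∀ a, Summable fun m => ‖c a m‖) :
    ∫ θ, ((χ₀ θ : Circle) : ℂ) * ∏ a, ∑' m : ℤ, c a m * ((χ a θ : Circle) : ℂ) ^ m ∂μ =
      ∑' n : ι → ℤ, if twistChar χ χ₀ n = 1 then ∏ a, c a (n a) else 0 := by
  -- pointwise expansion
  have hpt : ∀ θ, ((χ₀ θ : Circle) : ℂ) * ∏ a, ∑' m : ℤ, c a m * ((χ a θ : Circle) : ℂ) ^ m =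
      ∑' n : ι → ℤ, (∏ a, c a (n a)) * ((twistChar χ χ₀ n θ : Circle) : ℂ) := fun θ =>
    (hasSum_coe_char_mul_prod_tsum χ χ₀ hc θ).tsum_eq.symm
  simp_rw [hpt]
  -- term-by-term integration
  rw [integral_tsum]
  · refine tsum_congr fun n => ?_
    rw [integral_const_mul, integral_coe_char μ (twistChar χ χ₀ n)]
    split_ifs <;> simp
  · intro n
    exact (continuous_const.mul (continuous_subtype_val.comp
      (twistChar χ χ₀ n).continuous)).aestronglyMeasurable
  · have hle : ∀ n : ι → ℤ, ∫⁻ θ, ‖(∏ a, c a (n a)) * ((twistChar χ χ₀ n θ : Circle) : ℂ)‖ₑ ∂μ =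
        ENNReal.ofReal (∏ a, ‖c a (n a)‖) := fun n => by
      have h : ∀ θ, ‖(∏ a, c a (n a)) * ((twistChar χ χ₀ n θ : Circle) : ℂ)‖ₑ =
          ENNReal.ofReal (∏ a, ‖c a (n a)‖) := fun θ => by
        rw [← ofReal_norm, norm_mul, Circle.norm_coe, mul_one, norm_prod]
      simp_rw [h, lintegral_const, measure_univ, mul_one]
    simp_rw [hle]
    rw [← ENNReal.ofReal_tsum_of_nonneg (fun n => Finset.prod_nonneg fun a _ => norm_nonneg _)
      (summable_prod_norm hc)]
    exact ENNReal.ofReal_ne_top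

open Classical in
/-- **Character expansion of Ginibre models, complex form**:
`∫ χ₀(θ) e^{∑ₐ Jₐ Re χₐ(θ)} dθ = ∑_{n ∈ ℤ^ι} [χ₀ ∏ₐ χₐ^{nₐ} = 1] ∏ₐ I_{nₐ}(Jₐ)`.
[cite: FrohlichSpencerCMP1982, §2.3 (duality transformation); MontvayMunster1994 §3.2.7 (3.169)–(3.172)] -/
theorem integral_coe_char_mul_ginibreWeight (μ : Measure Ω) [μ.IsHaarMeasure]
    [IsProbabilityMeasure μ] (χ : ι → Ω →ₜ* Circle) (J : ι → ℝ) (χ₀ : Ω →ₜ* Circle) :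
    ∫ θ, ((χ₀ θ : Circle) : ℂ) * (ginibreWeight χ J θ : ℂ) ∂μ =
      ∑' n : ι → ℤ, if twistChar χ χ₀ n = 1 then ∏ a, (besselI (n a) (J a) : ℂ) else 0 := by
  classical
  simp_rw [coe_ginibreWeight_eq_prod_tsum]
  exact integral_coe_char_mul_prod_tsum μ χ χ₀ (c := fun a m => (besselI m (J a) : ℂ))
    fun a => summable_norm_coe_besselI (J a)

variable [CompactSpace Ω]

open Classical in
/-- **Character expansion of Ginibre models, real form**:
`∫ Re χ₀(θ) e^{∑ₐ Jₐ Re χₐ(θ)} dθ = ∑_{n ∈ ℤ^ι} [χ₀ ∏ₐ χₐ^{nₐ} = 1] ∏ₐ I_{nₐ}(Jₐ)` — for `U(1)`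
lattice gauge theory, `Z_Λ ⟨W(ℒ)⟩_Λ` as the sum over integer plaquette fields bounded by the loop,
weighted by `∏ₚ I_{nₚ}(β)`. [cite: FrohlichSpencerCMP1982, §2.3 (duality transformation); MontvayMunster1994 §3.2.7 (3.169)–(3.172)] -/
theorem integral_reChar_mul_ginibreWeight (μ : Measure Ω) [μ.IsHaarMeasure]
    [IsProbabilityMeasure μ] (χ : ι → Ω →ₜ* Circle) (J : ι → ℝ) (χ₀ : Ω →ₜ* Circle) :
    ∫ θ, reChar χ₀ θ * ginibreWeight χ J θ ∂μ =
      ∑' n : ι → ℤ, if twistChar χ χ₀ n = 1 then ∏ a, besselI (n a) (J a) else 0 := by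
  classical
  have hint : Integrable (fun θ => ((χ₀ θ : Circle) : ℂ) * (ginibreWeight χ J θ : ℂ)) μ :=
    ((continuous_subtype_val.comp χ₀.continuous).mul
      (Complex.continuous_ofReal.comp (continuous_ginibreWeight χ J))).integrable_of_hasCompactSupport
      (HasCompactSupport.of_compactSpace _)
  have hre : ∫ θ, reChar χ₀ θ * ginibreWeight χ J θ ∂μ =
      (∫ θ, ((χ₀ θ : Circle) : ℂ) * (ginibreWeight χ J θ : ℂ) ∂μ).re := by
    have h := integral_re hint
    simp only [RCLike.re_to_complex, Complex.mul_re, Complex.ofReal_re, Complex.ofReal_im,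
      mul_zero, sub_zero] at h
    rw [← h]
    rfl
  have hcast : (∑' n : ι → ℤ, if twistChar χ χ₀ n = 1 then ∏ a, (besselI (n a) (J a) : ℂ) else 0) =
      ((∑' n : ι → ℤ, if twistChar χ χ₀ n = 1 then ∏ a, besselI (n a) (J a) else 0 : ℝ) : ℂ) := by
    rw [Complex.ofReal_tsum]
    refine tsum_congr fun n => ?_
    split_ifs <;> simp [Complex.ofReal_prod]
  rw [hre, integral_coe_char_mul_ginibreWeight, hcast, Complex.ofReal_re]

open Classical in
/-- **The partition function of a Ginibre model**:
`∫ e^{∑ₐ Jₐ Re χₐ(θ)} dθ = ∑_{n ∈ ℤ^ι} [∏ₐ χₐ^{nₐ} = 1] ∏ₐ I_{nₐ}(Jₐ)` (for `U(1)` lattice gauge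
theory: `Z_Λ` as the sum over closed integer plaquette fields). [cite: FrohlichSpencerCMP1982, §2.3 (duality transformation); MontvayMunster1994 §3.2.7 (3.169)–(3.172)] -/
theorem integral_ginibreWeight_eq_tsum (μ : Measure Ω) [μ.IsHaarMeasure] [IsProbabilityMeasure μ]
    (χ : ι → Ω →ₜ* Circle) (J : ι → ℝ) :
    ∫ θ, ginibreWeight χ J θ ∂μ =
      ∑' n : ι → ℤ, if twistChar χ 1 n = 1 then ∏ a, besselI (n a) (J a) else 0 := by
  have h := integral_reChar_mul_ginibreWeight μ χ J 1
  simpa [reChar] using h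

open Classical in
/-- **The Gibbs expectation of a character in the dual variables**:
`⟨Re χ₀⟩_J = (∑ₙ [χ₀ ∏ₐ χₐ^{nₐ} = 1] ∏ₐ I_{nₐ}(Jₐ)) / (∑ₙ [∏ₐ χₐ^{nₐ} = 1] ∏ₐ I_{nₐ}(Jₐ))`
(for `U(1)` lattice gauge theory: `⟨W(ℒ)⟩_Λ = Z_Λ(ℒ)/Z_Λ`, the ratio of the dual partition
functions with and without the loop source). [cite: FrohlichSpencerCMP1982, §2.3 (duality transformation); MontvayMunster1994 §3.2.7 (3.169)–(3.172)] -/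
theorem ginibreExpect_reChar_eq_tsum_div_tsum (μ : Measure Ω) [μ.IsHaarMeasure]
    [IsProbabilityMeasure μ] (χ : ι → Ω →ₜ* Circle) (J : ι → ℝ) (χ₀ : Ω →ₜ* Circle) :
    ginibreExpect μ χ J (reChar χ₀) =
      (∑' n : ι → ℤ, if twistChar χ χ₀ n = 1 then ∏ a, besselI (n a) (J a) else 0) /
        ∑' n : ι → ℤ, if twistChar χ 1 n = 1 then ∏ a, besselI (n a) (J a) else 0 := by
  rw [ginibreExpect, integral_reChar_mul_ginibreWeight, integral_ginibreWeight_eq_tsum]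

end Expansion

end Literature.Probability.LatticeModels
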